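import Mathlib.LinearAlgebra.JordanChevalley
import Mathlib.LinearAlgebra.Lagrange
import Mathlib.RingTheory.PowerSeries.Binomial
import Mathlib.RingTheory.PowerSeries.Trunc
import Mathlib.FieldTheory.IsAlgClosed.Basic
import Mathlib.FieldTheory.Perfect
import Literature.NumberTheory.Kottwitz1992.Involutions
import HarnessLib

/-!
# [Kottwitz1992, §1 p. 379] Transitivity of `B^×` on `B_sym^×` over an algebraically closed field — DISCHARGED:
# `Kottwitz1992_1_unitsAct_transitive_holds`

Kernel-lane companion of the statement carpet ★ `Literature/NumberTheory/Kottwitz1992/Involutions.lean` (squad TK, TK-t01): the named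
fact ★ `Involutions.Kottwitz1992_1_unitsAct_transitive` — «When `F` is algebraically closed, the action [`x ↦ b x b*` of `B^×`] is
transitive on this subset [`B_sym^×`]» (p. 379) — is PROVED here as
`theorem Kottwitz1992_1_unitsAct_transitive_holds : Kottwitz1992_1_unitsAct_transitive F B ι`.  THEOREMS ONLY (no definition, no named
fact, no `sorry`, no instance, no notation); cell hodgecm-mathlib, seat B-typ04 (g30); net debt −1.

R. E. Kottwitz, *Points on some Shimura varieties over finite fields*, J. Amer. Math. Soc. 5 (1992), §1 p. 379 L1–L5 (held
`paper:doi-10-2307-2152772`, p0007).  THE PRINT: «When `F` is algebraically closed, the action is transitive on this subset, as one sees by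
examining the three irreducible cases discussed above, keeping in mind that over an algebraically closed field of characteristic different
from 2 any two nondegenerate symmetric bilinear forms are equivalent.»

DECLARED DEVIATION (a genuinely shorter road; the printed route goes through the §1 classification of irreducible algebras with involution,
the still-unproved letter ★ `Kottwitz1992_1_irreducible_classification`, and the classification of symmetric and alternating forms).  We prove
the transitivity DIRECTLY from the existence of polynomial square roots: over an algebraically closed field `F` of characteristic `0`, every
unit `x` of the finite-dimensional algebra `B` has a square root `b ∈ F[x]` (§3); if `x* = x` then `*` fixes `F[x]` pointwise (§1), so
`b* = b` and `x = b b*`; hence any two symmetric units `x = c c*`, `y = d d*` are related by `y = (d c⁻¹) x (d c⁻¹)*` (§4), exactly as in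
the proof of Lemma 2.8.  The square root (§3) is assembled from Mathlib's Jordan–Chevalley decomposition `x = s + n` inside `F[x]`
(`Module.End.exists_isNilpotent_isSemisimple`, read on `B` through the left regular representation): the semisimple part `s` has a
squarefree, split minimal polynomial, and the Lagrange interpolation polynomial `p` of a square-root function on its roots satisfies
`p(s)² = s` (§2); the unipotent factor `1 + m`, `m = r⁻² n` nilpotent (`r = p(s)`), has the square root `q(m)`, `q` a truncation of the binomial
series `(1 + X)^{1/2}` (Mathlib `PowerSeries.binomialSeries`, `binomialSeries_add`) (§2).
HONEST LABEL: HC_CM is proved only modulo the 7 printed citations (2 remaining: hLiu418, h413) until rung 0 closes; this file adds no citation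
debt (0 facts, 0 sorry) and discharges 1 named fact of ★ `Involutions`.

## References
* [Kottwitz1992] R. E. Kottwitz, Points on some Shimura varieties over finite fields, J. Amer. Math. Soc. 5 (1992) 373–444, §1 pp. 378–379.
-/

noncomputable section

namespace Literature.NumberTheory.Kottwitz1992.Involutions

open Polynomial

/-! ## §1 The commutative subalgebra `F[x]`: commutation, inverses, and the action of an involution fixing `x` -/

section Adjoin

variable {F : Type*} [Field F] {B : Type*} [Ring B] [Algebra F B] {ι : B →ₗ[F] B}

/-- An involution fixes `1`. [cite: Kottwitz1992, §1 (p. 378)] -/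
private theorem invol_map_one (hι : IsInvolution F B ι) : ι 1 = 1 := by
  have h : ι (ι 1 * 1) = ι 1 * ι (ι 1) := hι.map_mul (ι 1) 1
  rw [mul_one, hι.apply_apply, mul_one] at h
  exact h.symm

/-- Elements of `F[x]` commute with one another. [folklore] -/
private theorem commute_of_mem_adjoin_singleton {x a b : B} (ha : a ∈ Algebra.adjoin F {x})
    (hb : b ∈ Algebra.adjoin F {x}) : Commute a b :=
  Algebra.commute_of_mem_adjoin_of_forall_mem_commute hb fun y hy => by
    rw [Set.mem_singleton_iff] at hy
    subst hy
    exact (Algebra.commute_of_mem_adjoin_of_forall_mem_commute ha fun z hz => by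
      rw [Set.mem_singleton_iff] at hz
      subst hz
      exact Commute.refl _).symm

/-- `F[x]` is closed under the inverses that exist in the finite-dimensional `B` (left multiplication by a unit `u ∈ F[x]` is an injective,
hence surjective, endomorphism of `F[x]`). [folklore] -/
private theorem units_inv_mem_adjoin [FiniteDimensional F B] {x : B} (u : Bˣ) (hu : (u : B) ∈ Algebra.adjoin F {x}) :
    ((u⁻¹ : Bˣ) : B) ∈ Algebra.adjoin F {x} := by
  let A : Submodule F B := Subalgebra.toSubmodule (Algebra.adjoin F {x})
  have hA : ∀ a ∈ A, LinearMap.mulLeft F (u : B) a ∈ A := fun a ha => (Algebra.adjoin F {x}).mul_mem hu ha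
  let Lu : A →ₗ[F] A := (LinearMap.mulLeft F (u : B)).restrict hA
  have hLu : ∀ a : A, ((Lu a : A) : B) = (u : B) * a := fun a => rfl
  have hinj : Function.Injective Lu := by
    intro a b hab
    apply Subtype.ext
    have h := congrArg (fun c : A => ((u⁻¹ : Bˣ) : B) * (c : B)) hab
    simpa only [hLu, Units.inv_mul_cancel_left] using h
  obtain ⟨a, ha⟩ := (LinearMap.injective_iff_surjective.mp hinj) ⟨1, (Algebra.adjoin F {x}).one_mem⟩
  have h1 : (u : B) * a = 1 := by rw [← hLu, ha]
  rw [Units.inv_eq_of_mul_eq_one_right h1]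
  exact a.2

/-- An anti-automorphism maps powers to powers: `(x^n)* = (x*)^n`. [cite: Kottwitz1992, §1 (p. 378)] -/
private theorem invol_pow (hι : IsInvolution F B ι) (x : B) (n : ℕ) : ι (x ^ n) = ι x ^ n := by
  induction n with
  | zero => rw [pow_zero, pow_zero, invol_map_one hι]
  | succ n ih => rw [pow_succ, hι.map_mul, ih, ← pow_succ']

/-- `(p(x))* = p(x*)` for a polynomial `p ∈ F[X]`. [cite: Kottwitz1992, §1 (p. 378)] -/
private theorem invol_aeval (hι : IsInvolution F B ι) (x : B) (p : F[X]) : ι (aeval x p) = aeval (ι x) p := by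
  rw [aeval_eq_sum_range, aeval_eq_sum_range, map_sum]
  refine Finset.sum_congr rfl fun i _ => ?_
  rw [map_smul, invol_pow hι]

/-- If `x* = x` then `*` fixes `F[x]` pointwise. [cite: Kottwitz1992, §1 (p. 378)] -/
private theorem invol_eq_self_of_mem_adjoin (hι : IsInvolution F B ι) {x : B} (hx : ι x = x) {a : B}
    (ha : a ∈ Algebra.adjoin F {x}) : ι a = a := by
  rw [Algebra.adjoin_singleton_eq_range_aeval] at ha
  obtain ⟨p, rfl⟩ := (AlgHom.mem_range _).mp ha
  rw [invol_aeval hι, hx]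

end Adjoin

/-! ## §2 Square roots: of a unipotent `1 + m` (binomial series) and of a semisimple element (Lagrange interpolation) -/

section SquareRoots

variable (F : Type*) [Field F] {B : Type*} [Ring B] [Algebra F B]

/-- For nilpotent `m` (characteristic `0`) there is `t ∈ F[m]` with `t² = 1 + m`: `t = q(m)` for `q` the truncation of the binomial series
`(1 + X)^{1/2}` beyond the nilpotency order, since `((1 + X)^{1/2})² = 1 + X` as power series and evaluation at `m` of truncations is
multiplicative. [folklore] -/
private theorem exists_sq_eq_one_add_of_isNilpotent [CharZero F] {m : B} (hm : IsNilpotent m) :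
    ∃ t ∈ Algebra.adjoin F {m}, t * t = 1 + m := by
  obtain ⟨N₀, hN₀⟩ := hm
  have hmN : m ^ (N₀ + 2) = 0 := by rw [pow_add, hN₀, zero_mul]
  have h2N : 2 ≤ N₀ + 2 := Nat.le_add_left 2 N₀
  -- the binomial series `(1 + X)^{1/2}` over `F` and its square
  let φ : PowerSeries F := PowerSeries.binomialSeries F (2⁻¹ : F)
  have hφ : φ * φ = 1 + PowerSeries.X := by
    show PowerSeries.binomialSeries F (2⁻¹ : F) * PowerSeries.binomialSeries F (2⁻¹ : F) = _
    have h1 : (2⁻¹ : F) + 2⁻¹ = ((1 : ℕ) : F) := by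
      rw [Nat.cast_one, ← two_mul, mul_inv_cancel₀ (two_ne_zero : (2 : F) ≠ 0)]
    rw [← PowerSeries.binomialSeries_add, h1, PowerSeries.binomialSeries_nat, pow_one]
  -- evaluation at `m` only sees the truncation below `X^(N₀+2)`
  have key : ∀ P : F[X], aeval m (PowerSeries.trunc (N₀ + 2) (P : PowerSeries F)) = aeval m P := by
    intro P
    rw [Polynomial.aeval_def, PowerSeries.eval₂_trunc_eq_sum_range,
      Polynomial.aeval_eq_sum_range' (lt_max_of_lt_right (Nat.lt_succ_self _) : P.natDegree < max (N₀ + 2) (P.natDegree + 1))]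
    simp only [Polynomial.coeff_coe, Algebra.smul_def]
    refine Finset.sum_subset (Finset.range_mono (le_max_left _ _)) fun i _ hiN => ?_
    rw [Finset.mem_range, not_lt] at hiN
    obtain ⟨k, rfl⟩ := Nat.exists_eq_add_of_le hiN
    rw [pow_add, hmN, zero_mul, mul_zero]
  have htr1 : PowerSeries.trunc (N₀ + 2) (1 : PowerSeries F) = 1 := PowerSeries.trunc_one (N₀ + 1)
  refine ⟨aeval m (PowerSeries.trunc (N₀ + 2) φ), Polynomial.aeval_mem_adjoin_singleton F m, ?_⟩
  rw [← map_mul, ← key, Polynomial.coe_mul, PowerSeries.trunc_trunc_mul_trunc, hφ, map_add, htr1,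
    PowerSeries.trunc_X_of h2N, map_add, map_one, Polynomial.aeval_X]

/-- An element `s` (integral over the algebraically closed `F`) whose minimal polynomial is squarefree has a square root `r ∈ F[s]`:
the minimal polynomial is a product of distinct linear factors `X − λ`, the Lagrange polynomial `p` with `p(λ) = √λ` at each root satisfies
`(X − λ) ∣ p² − X` for every root, hence `minpoly ∣ p² − X` and `p(s)² = s`. [folklore] -/
private theorem exists_sq_eq_of_squarefree_minpoly [IsAlgClosed F] {s : B} (hint : IsIntegral F s)
    (hsq : Squarefree (minpoly F s)) : ∃ r ∈ Algebra.adjoin F {s}, r * r = s := by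
  classical
  -- a square-root function on `F`
  have hsqF : ∀ a : F, ∃ z : F, z * z = a := fun a => by
    obtain ⟨z, hz⟩ := IsAlgClosed.exists_eq_mul_self a
    exact ⟨z, hz.symm⟩
  choose sq hsq' using hsqF
  have hmonic : (minpoly F s).Monic := minpoly.monic hint
  have hsplit : (minpoly F s).Splits := IsAlgClosed.splits _
  have hnodup : (minpoly F s).roots.Nodup := Polynomial.nodup_roots (PerfectField.separable_iff_squarefree.mpr hsq)
  -- Lagrange interpolation of `√` on the roots
  let p : F[X] := Lagrange.interpolate (minpoly F s).roots.toFinset id sq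
  have hp : ∀ a ∈ (minpoly F s).roots.toFinset, (p * p - X).IsRoot a := fun a ha => by
    have he : p.eval a = sq a := by
      have h := Lagrange.eval_interpolate_at_node sq (Set.injOn_id _) ha
      exact h
    simp only [IsRoot.def, eval_sub, eval_mul, eval_X, he, hsq', sub_self]
  -- `minpoly ∣ p² − X`
  have hdvd : minpoly F s ∣ p * p - X := by
    have hprod : (∏ a ∈ (minpoly F s).roots.toFinset, (X - C a)) = minpoly F s := by
      rw [Finset.prod_eq_multiset_prod, Multiset.toFinset_val, hnodup.dedup]
      exact (hsplit.eq_prod_roots_of_monic hmonic).symm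
    rw [← hprod]
    refine Finset.prod_dvd_of_coprime ?_ fun a ha => (Polynomial.dvd_iff_isRoot).mpr (hp a ha)
    exact (Polynomial.pairwise_coprime_X_sub_C (s := id) Function.injective_id).set_pairwise _
  refine ⟨aeval s p, Polynomial.aeval_mem_adjoin_singleton F s, ?_⟩
  obtain ⟨q, hq⟩ := hdvd
  have h0 : aeval s (p * p - X) = 0 := by rw [hq, map_mul, minpoly.aeval, zero_mul]
  rwa [map_sub, map_mul, aeval_X, sub_eq_zero] at h0

/-! ## §3 Every unit of `B` has a square root in `F[x]` -/

/-- Over an algebraically closed field of characteristic `0`, every unit `x` of the finite-dimensional algebra `B` has a square root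
`b ∈ F[x]`: with the Jordan–Chevalley decomposition `x = s + n` in `F[x]` (`s` semisimple, `n` nilpotent — Mathlib, read through the left
regular representation `B → End_F(B)`), `s = x − n` is a unit, `r ∈ F[s]` with `r² = s` (§2), `m = r⁻² n` is nilpotent, `t ∈ F[m]` with
`t² = 1 + m` (§2), and `b = r t` has `b² = r² t² = s (1 + m) = s + n = x`. [folklore] -/
private theorem exists_sq_eq_of_isUnit [IsAlgClosed F] [CharZero F] [FiniteDimensional F B] (x : Bˣ) :
    ∃ b ∈ Algebra.adjoin F {(x : B)}, b * b = x := by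
  have hLinj : Function.Injective (Algebra.lmul F B) := Algebra.lmul_injective
  -- Jordan–Chevalley for `L_x`
  obtain ⟨n, hn, s, hs, hnil, hss, hdec⟩ := Module.End.exists_isNilpotent_isSemisimple (f := Algebra.lmul F B x)
  rw [← AlgHom.map_adjoin_singleton] at hn hs
  obtain ⟨n₀, hn₀, rfl⟩ := Subalgebra.mem_map.mp hn
  obtain ⟨s₀, hs₀, rfl⟩ := Subalgebra.mem_map.mp hs
  have hx : (x : B) = n₀ + s₀ := hLinj (by rw [map_add]; exact hdec)
  have hn₀nil : IsNilpotent n₀ := by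
    obtain ⟨k, hk⟩ := hnil
    exact ⟨k, hLinj (by rw [map_pow, hk, map_zero])⟩
  have hs₀sq : Squarefree (minpoly F s₀) := by
    rw [← minpoly.algHom_eq (Algebra.lmul F B) hLinj s₀]
    exact hss.minpoly_squarefree
  have hxA : (x : B) ∈ Algebra.adjoin F {(x : B)} := Algebra.self_mem_adjoin_singleton F (x : B)
  -- `s₀` is a unit
  have hs₀u : IsUnit s₀ := by
    have h1 : s₀ = -n₀ + x := by rw [hx, neg_add_cancel_left]
    rw [h1]
    exact hn₀nil.neg.isUnit_add_right_of_commute x.isUnit (commute_of_mem_adjoin_singleton hn₀ hxA).neg_left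
  -- square root `r` of `s₀`
  obtain ⟨r, hr, hrr⟩ := exists_sq_eq_of_squarefree_minpoly F (Algebra.IsIntegral.isIntegral s₀) hs₀sq
  have hrA : r ∈ Algebra.adjoin F {(x : B)} := Algebra.adjoin_le (Set.singleton_subset_iff.mpr hs₀) hr
  -- `r` is a unit
  obtain ⟨su, hsu⟩ := hs₀u
  have hrs : Commute r (su : B) := hsu ▸ commute_of_mem_adjoin_singleton hrA hs₀
  have hru : IsUnit r := by
    refine ⟨⟨r, r * ((su⁻¹ : Bˣ) : B), ?_, ?_⟩, rfl⟩
    · rw [← mul_assoc, hrr, ← hsu, Units.mul_inv]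
    · rw [hrs.units_inv_right.eq, mul_assoc, hrr, ← hsu, Units.inv_mul]
  obtain ⟨ru, hru'⟩ := hru
  have hriA : ((ru⁻¹ : Bˣ) : B) ∈ Algebra.adjoin F {(x : B)} := units_inv_mem_adjoin ru (hru'.symm ▸ hrA)
  -- the nilpotent `m = r⁻² n₀` and its unipotent square root
  have hmA : ((ru⁻¹ : Bˣ) : B) * ((ru⁻¹ : Bˣ) : B) * n₀ ∈ Algebra.adjoin F {(x : B)} :=
    Subalgebra.mul_mem _ (Subalgebra.mul_mem _ hriA hriA) hn₀
  have hmnil : IsNilpotent (((ru⁻¹ : Bˣ) : B) * ((ru⁻¹ : Bˣ) : B) * n₀) :=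
    (commute_of_mem_adjoin_singleton (Subalgebra.mul_mem _ hriA hriA) hn₀).isNilpotent_mul_left hn₀nil
  obtain ⟨t, ht, htt⟩ := exists_sq_eq_one_add_of_isNilpotent F hmnil
  have htA : t ∈ Algebra.adjoin F {(x : B)} := Algebra.adjoin_le (Set.singleton_subset_iff.mpr hmA) ht
  refine ⟨r * t, Subalgebra.mul_mem _ hrA htA, ?_⟩
  have hrt : Commute t r := commute_of_mem_adjoin_singleton htA hrA
  calc r * t * (r * t) = r * r * (t * t) := hrt.mul_mul_mul_comm r t
    _ = s₀ * (1 + ((ru⁻¹ : Bˣ) : B) * ((ru⁻¹ : Bˣ) : B) * n₀) := by rw [hrr, htt]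
    _ = s₀ + n₀ := by
      rw [mul_add, mul_one, ← hrr, ← hru']
      simp only [mul_assoc, Units.mul_inv_cancel_left]
    _ = x := by rw [hx, add_comm]

end SquareRoots

/-! ## §4 Transitivity -/

section Transitive

variable (F : Type*) [Field F] (B : Type*) [Ring B] [Algebra F B] (ι : B →ₗ[F] B)

/-- **§1 TRANSITIVITY, PROVED**: ★ `Kottwitz1992_1_unitsAct_transitive` holds — for `F` algebraically closed of characteristic `0` and `B`
finite-dimensional (semisimple), `B^×` acts transitively on `B_sym^×` by `x ↦ b x b*`.  Every symmetric unit is `c c*` with `c = c*` a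
polynomial square root (§3, §1), and `d d* = (d c⁻¹)(c c*)(d c⁻¹)*`.  (Shorter road than the print's inspection of the three irreducible
cases; see the module docstring.) [cite: Kottwitz1992, §1 (p. 379)] -/
theorem Kottwitz1992_1_unitsAct_transitive_holds : Kottwitz1992_1_unitsAct_transitive F B ι := by
  intro _ _ _ _ hι x hx y hy
  -- every symmetric unit is `c c*` with `c* = c`
  have key : ∀ z : Bˣ, z ∈ symUnits ι → ∃ c : Bˣ, (z : B) = c * ι c ∧ ι (c : B) = c := by
    intro z hz
    have hz' : ι (z : B) = z := hz
    obtain ⟨b, hb, hbb⟩ := exists_sq_eq_of_isUnit F z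
    have hιb : ι b = b := invol_eq_self_of_mem_adjoin hι hz' hb
    have hbz : Commute b (z : B) := commute_of_mem_adjoin_singleton hb (Algebra.self_mem_adjoin_singleton F (z : B))
    refine ⟨⟨b, b * ((z⁻¹ : Bˣ) : B), ?_, ?_⟩, ?_, hιb⟩
    · rw [← mul_assoc, hbb, Units.mul_inv]
    · rw [hbz.units_inv_right.eq, mul_assoc, hbb, Units.inv_mul]
    · show (z : B) = b * ι b
      rw [hιb, hbb]
  obtain ⟨c, hxc, -⟩ := key x hx
  obtain ⟨d, hyd, -⟩ := key y hy
  refine ⟨d * c⁻¹, ?_⟩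
  show ((d * c⁻¹ : Bˣ) : B) * x * ι ((d * c⁻¹ : Bˣ) : B) = y
  rw [hxc, hyd, Units.val_mul, hι.map_mul]
  have h1 : ι (c : B) * ι ((c⁻¹ : Bˣ) : B) = 1 := by rw [← hι.map_mul, Units.inv_mul, invol_map_one hι]
  calc (d : B) * ((c⁻¹ : Bˣ) : B) * ((c : B) * ι c) * (ι ((c⁻¹ : Bˣ) : B) * ι d)
      = (d : B) * (((c⁻¹ : Bˣ) : B) * (c : B)) * (ι (c : B) * ι ((c⁻¹ : Bˣ) : B)) * ι d := by simp only [mul_assoc]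
    _ = (d : B) * ι d := by rw [Units.inv_mul, h1, mul_one, mul_one]

end Transitive

end Literature.NumberTheory.Kottwitz1992.Involutions

end
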